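import Summits.QuantumFields.QCD.Theses.HeatSlicedQuarks

/-!
# Sketch (crux-ideate round 1, ideator 2) — crux `TracedQuadraticParametrix`
(item stmt-QuantumFields-17985, route HeatSlicedQuarks).

Typed FIRST LEMMAS of the three idea cards this seat files (nothing is proved; every `def … : Prop`
merely has to elaborate):

* card `complex-amplitude-cauchy` : `ComplexAmplitudeUltracontractivity` (load-bearing stub, link-profile
  form over `GL(3,ℂ)`-valued configurations and the tree's already-holomorphic `wilsonDirac`),
  `CauchySecondRemainder` (the Schwarz/Cauchy step), `HolomorphicSquareAgrees` (bridge to `Dᴴ D`).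
* card `unsquare-by-parts` : `HermitianWilsonSquare` (`H = 𝒬²`, `𝒬 = γ₅ D_W` Hermitian),
  `SU3TraceDeviationLeDeficit` (colour trace of a link deviation is second order),
  `OneDerivativeFreeKernel` (the `τ^{-5/2}` bound for `𝒬₁ e^{-τ 𝒬₁²}`, free lattice).
* card `riesz-square-function` : `FreeWilsonRiesz` (`‖∇v‖² ≤ C ‖D₁ v‖²`, the lattice Riesz-transform
  bound that makes the time-integrated two-current sandwich `ℓ²`-bounded).

Conventions: `wilsonDirac ρ U m 1` is the tree's `r = 1` Wilson operator (backward hops use `ρ(U)⁻¹`,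
so it is a polynomial in the link matrices and their inverses — holomorphic); `H_U = D_Wᴴ D_W`;
`𝒬_U = spinorLift γ₅ * D_W(U)`.
-/

namespace Summit.QuantumFields.QCD.Cruxes.TracedQuadraticParametrix.Ideator2

open Literature.MathematicalPhysics.QuantumLattice Literature.MathematicalPhysics.QuantumFieldTheory
open Literature.Probability.LatticeModels Matrix
open scoped Matrix ComplexConjugate BigOperators

/-- The `SU(3)` fundamental representation, abbreviated. -/
noncomputable abbrev ρ3 : Matrix.specialUnitaryGroup (Fin 3) ℂ →* Matrix (Fin 3) (Fin 3) ℂ :=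
  fundamentalRep (Fin 3)

/-- The defining representation of `GL(3,ℂ) = (M₃(ℂ))ˣ`: the coercion to matrices (a monoid hom). The tree's
`wilsonDirac` accepts any group with a matrix representation and uses `ρ(U)⁻¹` (not `ρ(U)ᴴ`) on backward hops,
so `wilsonDirac ρGL U m 1` is the holomorphic extension of the Wilson–Dirac operator to complex link variables. -/
noncomputable abbrev ρGL : GL (Fin 3) ℂ →* Matrix (Fin 3) (Fin 3) ℂ :=
  Units.coeHom (Matrix (Fin 3) (Fin 3) ℂ)

/-- The HOLOMORPHIC SQUARE `𝐇(U) = γ₅ D(U) γ₅ D(U)` of the Wilson–Dirac operator over an arbitrary matrix group: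
a polynomial in the link matrices and their inverses; on unitary configurations it is `D(U)ᴴ D(U)` by
γ₅-hermiticity (`HolomorphicSquareAgrees`). -/
noncomputable def holoSquare {G : Type*} [Group G] (ρ : G →* Matrix (Fin 3) (Fin 3) ℂ) {L : ℕ} [NeZero L]
    (U : GaugeConfig 4 L G) (m : ℝ) :
    Matrix (TorusSite 4 L × Fin 3 × Fin 4) (TorusSite 4 L × Fin 3 × Fin 4) ℂ :=
  spinorLift (L := L) (N := 3) gammaFive * wilsonDirac ρ U m 1 * spinorLift (L := L) (N := 3) gammaFive *
    wilsonDirac ρ U m 1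

/-! ## Card `complex-amplitude-cauchy` -/

/-- **First lemma / load-bearing stub (complex-amplitude ultracontractivity, link-profile form).**  There are
`ρ₀ > 0` and `C` such that for every `GL(3,ℂ)`-valued configuration `U` on `(ℤ/L)⁴` whose links AND inverse
links deviate from `1` entrywise by at most `ρ₀ (d(x,z)+1)/t` (the complexified comb profile at amplitude
`|ζ| = ρ₀/(δt)`: unitary part = a real field with flux `≤ ρ₀` per diffusion area, positive part = an
"imaginary magnetic field" = drift of slope `ρ₀/t`), every `m ∈ [-1/2,1]` and `1 ≤ t ≤ L²`, the colour–spin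
traced on-diagonal kernel of `exp(-t 𝐇(U))` at `x` is of FREE size: `≤ C/t²`.  With `CauchySecondRemainder`
and tracelessness of `su(3)` this gives `TracedQuadraticParametrix` with constant `C/ρ₀²`. -/
def ComplexAmplitudeUltracontractivity : Prop :=
  ∃ ρ₀ : ℝ, 0 < ρ₀ ∧ ∃ C : ℝ, ∀ (L : ℕ) [NeZero L] (U : GaugeConfig 4 L (GL (Fin 3) ℂ)) (m : ℝ),
    m ∈ Set.Icc (-(1 / 2 : ℝ)) 1 → ∀ (x : TorusSite 4 L) (t : ℝ), 1 ≤ t → t ≤ (L : ℝ) ^ 2 →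
    (∀ (z : TorusSite 4 L) (μ : Fin 4) (i j : Fin 3),
        ‖((U (z, μ) : GL (Fin 3) ℂ) : Matrix (Fin 3) (Fin 3) ℂ) i j - (1 : Matrix (Fin 3) (Fin 3) ℂ) i j‖ ≤
            ρ₀ * ((torusDist x z : ℝ) + 1) / t ∧
          ‖((U (z, μ))⁻¹ : Matrix (Fin 3) (Fin 3) ℂ) i j - (1 : Matrix (Fin 3) (Fin 3) ℂ) i j‖ ≤
            ρ₀ * ((torusDist x z : ℝ) + 1) / t) →
    ‖∑ a : Fin 3, ∑ α : Fin 4, (NormedSpace.exp (-(t : ℂ) • holoSquare ρGL U m)) (x, a, α) (x, a, α)‖ ≤ C / t ^ 2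

/-- **The Cauchy/Schwarz step** (pure complex analysis, Mathlib-provable): a function holomorphic on a
neighbourhood of the closed disc of radius `R > 1`, vanishing to second order at `0` and bounded by `M` on the
circle, is at most `M/(R(R-1))` at `ζ = 1` (Cauchy's formula for the second Taylor remainder,
`f(1) = (2πi)⁻¹ ∮_{|ζ|=R} f(ζ) dζ/(ζ²(ζ-1))`). Used with `R = ρ₀/(δ t) ≥ 2`, `M = 2C/t²`. -/
def CauchySecondRemainder : Prop :=
  ∀ (f : ℂ → ℂ) (R M : ℝ), 1 < R → DifferentiableOn ℂ f (Metric.closedBall (0 : ℂ) (R + 1)) →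
    f 0 = 0 → deriv f 0 = 0 → (∀ z : ℂ, ‖z‖ = R → ‖f z‖ ≤ M) → ‖f 1‖ ≤ M / (R * (R - 1))

/-- **Bridge**: on `SU(3)` configurations the holomorphic square IS `Dᴴ D` (γ₅-hermiticity, proved in the tree as
`wilsonDirac_gammaFive_hermitian_holds`, and `γ₅² = 1`). -/
def HolomorphicSquareAgrees : Prop :=
  ∀ (L : ℕ) [NeZero L] (U : GaugeConfig 4 L (Matrix.specialUnitaryGroup (Fin 3) ℂ)) (m : ℝ),
    holoSquare ρ3 U m = (wilsonDirac ρ3 U m 1)ᴴ * wilsonDirac ρ3 U m 1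

/-! ## Card `unsquare-by-parts` -/

/-- **`H = 𝒬²` with `𝒬 = γ₅ D_W` Hermitian** (un-squaring): for every `SU(3)` configuration and real mass. -/
def HermitianWilsonSquare : Prop :=
  ∀ (L : ℕ) [NeZero L] (U : GaugeConfig 4 L (Matrix.specialUnitaryGroup (Fin 3) ℂ)) (m : ℝ),
    (spinorLift (L := L) (N := 3) gammaFive * wilsonDirac ρ3 U m 1)ᴴ =
        spinorLift (L := L) (N := 3) gammaFive * wilsonDirac ρ3 U m 1 ∧
      (wilsonDirac ρ3 U m 1)ᴴ * wilsonDirac ρ3 U m 1 =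
        (spinorLift (L := L) (N := 3) gammaFive * wilsonDirac ρ3 U m 1) *
          (spinorLift (L := L) (N := 3) gammaFive * wilsonDirac ρ3 U m 1)

/-- **The colour trace of a link deviation is second order**: `|tr(W - 1)| ≤ C (3 - Re tr W)` on all of `SU(3)`
(near `1`: `Im tr W = Σ sin θ_k = -Σ θ_k³/6 + …` since `Σ θ_k = 0`; away from `1`: compactness; `C = 2` works
numerically).  This is what turns the first-order Duhamel term of the TRACED kernel into `O(δ² (d+1)²)` per link. -/
def SU3TraceDeviationLeDeficit : Prop :=
  ∃ C : ℝ, ∀ W : Matrix.specialUnitaryGroup (Fin 3) ℂ,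
    ‖(ρ3 W).trace - 3‖ ≤ C * (3 - (ρ3 W).trace.re)

/-- **One-derivative free kernel** (the `σ^{-1/2}` smoothing in pointwise form, free lattice Fourier analysis):
`|[𝒬₁ e^{-τ 𝒬₁²}](x,y)| ≤ C τ^{-5/2} e^{-c d²/(τ+d)}` for `1 ≤ τ ≤ L²`, all `m ∈ [-1/2,1]` (no doubler becomes
massless in this range), where `𝒬₁ = γ₅ D_W(1)` and `d` is the torus distance. Every propagator of the un-squared
Duhamel series carries at most one `𝒬₁` after the by-parts step, so this and the landed `τ⁻²` kernel bounds are
the only free inputs. -/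
def OneDerivativeFreeKernel : Prop :=
  ∃ C c : ℝ, 0 < c ∧ ∀ (L : ℕ) [NeZero L] (m : ℝ), m ∈ Set.Icc (-(1 / 2 : ℝ)) 1 →
    ∀ (τ : ℝ), 1 ≤ τ → τ ≤ (L : ℝ) ^ 2 →
    ∀ (x y : TorusSite 4 L) (a b : Fin 3) (α β : Fin 4),
      ‖(spinorLift (L := L) (N := 3) gammaFive *
            wilsonDirac ρ3 (fun _ : Edge 4 L => (1 : Matrix.specialUnitaryGroup (Fin 3) ℂ)) m 1 *
          NormedSpace.exp (-(τ : ℂ) •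
            ((wilsonDirac ρ3 (fun _ : Edge 4 L => (1 : Matrix.specialUnitaryGroup (Fin 3) ℂ)) m 1)ᴴ *
              wilsonDirac ρ3 (fun _ : Edge 4 L => (1 : Matrix.specialUnitaryGroup (Fin 3) ℂ)) m 1)))
          (x, a, α) (y, b, β)‖ ≤
        C / τ ^ (5 / 2 : ℝ) *
          Real.exp (-(c * (torusDist x y : ℝ) ^ 2 / (τ + (torusDist x y : ℝ))))

/-! ## Card `riesz-square-function` -/

/-- **Free Wilson Riesz inequality** (the lattice Riesz transform `∇ (D₁ᴴD₁)^{-1/2}` is bounded): for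
`m ∈ [-1/2, 1]` and every quark field `v`, `Σ_{x,μ} ‖v(x+μ) - v(x)‖² ≤ C ‖D₁ v‖²` — in momentum space
`4 Σ sin²(p_μ/2) ≤ C [Σ sin² p_μ + (m + Σ(1 - cos p_μ))²]`, which holds exactly because no doubler is massless
for these masses (it FAILS at the doubler critical masses `m = -2, -4, …`).  Consequence used by the card:
`‖∫₀ᵀ ∇ e^{-σ H₁} ∇ᴴ dσ‖_{ℓ²→ℓ²} ≤ C` uniformly in `T` (no `log T`). -/
def FreeWilsonRiesz : Prop :=
  ∃ C : ℝ, ∀ (L : ℕ) [NeZero L] (m : ℝ), m ∈ Set.Icc (-(1 / 2 : ℝ)) 1 →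
    ∀ (v : TorusSite 4 L × Fin 3 × Fin 4 → ℂ),
      ∑ x : TorusSite 4 L, ∑ μ : Fin 4, ∑ a : Fin 3, ∑ α : Fin 4,
          ‖v (Literature.MathematicalPhysics.QuantumFieldTheory.Site.shift x μ, a, α) - v (x, a, α)‖ ^ 2 ≤
        C * ∑ i, ‖(wilsonDirac ρ3 (fun _ : Edge 4 L => (1 : Matrix.specialUnitaryGroup (Fin 3) ℂ)) m 1).mulVec
              v i‖ ^ 2

end Summit.QuantumFields.QCD.Cruxes.TracedQuadraticParametrix.Ideator2
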